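import Summits.CriticalPhenomena.CardyFormulaZ2.Theorems.CardyQContinuationIsingJetsConformalStubRcMeasureMonoDomainWired
import Literature.Probability.LatticeModels.FKIsingAnnulusCrossingProofs

/-!
# Crux `IsingJetsConformal`, stub `stub_loopSymmetricLimit_sandwichUpper`:
# upper half of the FK sandwich between the discretisation `Ω_δ` and a glued quadrilateral
# (route `CardyQContinuation`, item stmt-CriticalPhenomena-5560, `n = 0` bridge)

The `n = 0` bridge of the crux compares the wired FK measure of the tree's discretisation `Ω_δ`
(edge set `EΩ`, wired set `W`) with a Chelkak–Smirnov quadrilateral `Q` (edge set `EQ`, wired set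
`Z ⊇ W`) glued along a thick wired collar inside a common finite graph `G ⊇ EΩ ∪ EQ`: every edge
of `G` that is not a `Q`-edge has both endpoints in the big wired set `Z` (a "decoration"), and the
deterministic hypothesis says that a crossing of `Ω_δ` (event `A`, read on `ω ∩ EΩ`) forces a
crossing of `Q` (event `AQ`, read on `ω ∩ EQ`). Conclusion (this file):
`φ^W_{⟨EΩ⟩,p,q}(A) ≤ φ^Z_{⟨EQ⟩,p,q}(AQ)` for increasing `A`, `0 ≤ p < 1`, `q ≥ 1`.

The proof is a chain of four proved comparison facts of the `Literature` random-cluster library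
(`rcMeasure G p q B` = random-cluster measure of the finite graph `G` wired on `B`):

1. `φ^W_{⟨EΩ⟩}(A) ≤ φ^Z_G({ω | ω ∩ EΩ ∈ A})` — domain and wired-set monotonicity for increasing
   events (`stub_loopSymmetricLimit_rcMeasure_mono_domain_wired`, Grimmett 2006, Thm. (3.1)(a),
   Lemma (4.14));
2. `φ^Z_G({ω | ω ∩ EΩ ∈ A}) ≤ φ^Z_G({ω | ω ∩ EQ ∈ AQ})` — the deterministic inclusion on lattice
   configurations (`rcMeasure_real_mono_of_forall_subset_edgeSet`);
3. `φ^Z_G({ω | ω ∩ EQ ∈ AQ}) = φ^Z_{⟨EQ⟩}({ω | ω ∩ EQ ∈ AQ})` — edges off `EQ` join wired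
   vertices and integrate out (`rcMeasure_real_eq_fromEdgeSet_of_outside_wired`, the domain
   Markov property, Grimmett 2006, Lemma 4.13);
4. `φ^Z_{⟨EQ⟩}({ω | ω ∩ EQ ∈ AQ}) = φ^Z_{⟨EQ⟩}(AQ)` — the measure of `⟨EQ⟩` is carried by
   configurations `ω ⊆ EQ`, for which `ω ∩ EQ = ω`.

References: G. Grimmett, *The Random-Cluster Model*, Springer (2006), §1.2, Thm. (3.1)(a),
Lemmas 4.13, (4.14); H. Duminil-Copin, S. Smirnov, *Conformal invariance of lattice models*,
Clay Math. Proc. 15 (2012), §3.2; D. Chelkak, S. Smirnov, Invent. Math. 189 (2012), §1.2.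
No new definitions; nothing here is specific to the square lattice.
-/

namespace Summit.CriticalPhenomena.CardyFormulaZ2.Theorems.CardyQContinuation

open MeasureTheory SimpleGraph
open Literature.Probability.LatticeModels
open Literature.Probability.Percolation

noncomputable section

namespace SandwichUpper

/-- **Reading an event on a wired-off edge set.** If every edge of `G` outside `F ⊆ E(G)` has
both endpoints in the wired set `Z`, then for ANY event `A` the `φ^Z_{G,p,q}`-probability that the
`F`-part `ω ∩ F` of the configuration lies in `A` equals the `φ^Z_{⟨F⟩,p,q}`-probability of `A`
itself: the edges off `F` integrate out (domain Markov property with wired exterior, Grimmett 2006,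
Lemma 4.13), and the measure of the spanning graph `⟨F⟩` is carried by configurations `ω ⊆ F`,
for which `ω ∩ F = ω`. [cite: Grimmett2006, Lemma 4.13] -/
theorem rcMeasure_real_inter_mem_eq_fromEdgeSet {V : Type*} [Fintype V] [DecidableEq V]
    (G : SimpleGraph V) [DecidableRel G.Adj] {p q : ℝ} (hp : p ∈ Set.Icc (0 : ℝ) 1)
    (hq : 0 < q) (Z : Set V) (F : Finset (Sym2 V)) (hF : F ⊆ G.edgeFinset)
    (hZ : ∀ e ∈ G.edgeFinset, e ∉ F → ∀ x ∈ e, x ∈ Z) (A : Set (BondConfig V)) :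
    (rcMeasure G p q Z).real {ω | ω ∩ ↑F ∈ A} =
      (rcMeasure (fromEdgeSet (F : Set (Sym2 V))) p q Z).real A := by
  have h1 : (rcMeasure G p q Z).real {ω | ω ∩ ↑F ∈ A} =
      (rcMeasure (fromEdgeSet (F : Set (Sym2 V))) p q Z).real {ω | ω ∩ ↑F ∈ A} := by
    refine rcMeasure_real_eq_fromEdgeSet_of_outside_wired G hp hq Z F hF hZ fun ω _ ↦ ?_
    simp only [Set.mem_setOf_eq, Finset.coe_inter, Set.inter_assoc, Set.inter_self]
  -- configurations of `⟨F⟩` are subsets of `F`, on which `ω ∩ F = ω`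
  have hsub : ∀ ω : BondConfig V, ω ⊆ (fromEdgeSet (F : Set (Sym2 V))).edgeSet →
      ω ∩ ↑F = ω := fun ω hω ↦
    Set.inter_eq_left.2 fun e he ↦ ((edgeSet_fromEdgeSet (F : Set (Sym2 V))) ▸ hω he).1
  rw [h1]
  refine le_antisymm
    (rcMeasure_real_mono_of_forall_subset_edgeSet _ hp hq Z fun ω hω h ↦ ?_)
    (rcMeasure_real_mono_of_forall_subset_edgeSet _ hp hq Z fun ω hω h ↦ ?_)
  · simpa only [Set.mem_setOf_eq, hsub ω hω] using h
  · simpa only [Set.mem_setOf_eq, hsub ω hω] using h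

end SandwichUpper

open SandwichUpper

/-- **Stub `stub_loopSymmetricLimit_sandwichUpper`** of the skeleton of the crux
`IsingJetsConformal` (stmt-CriticalPhenomena-5560, `n = 0` bridge, upper half of the sandwich):
inside a finite graph `G` with edge sets `EΩ, EQ ⊆ E(G)` and wired sets `W ⊆ Z` such that every
edge of `G` off `EQ` has both endpoints in `Z`, if the increasing event `A` read on `ω ∩ EΩ` forces
the event `AQ` read on `ω ∩ EQ` for every lattice configuration `ω ⊆ E(G)`, then
`φ^W_{⟨EΩ⟩,p,q}(A) ≤ φ^Z_{⟨EQ⟩,p,q}(AQ)` (`0 ≤ p < 1`, `q ≥ 1`). Chain: domain/wired-set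
monotonicity (`stub_loopSymmetricLimit_rcMeasure_mono_domain_wired`), the deterministic inclusion
(`rcMeasure_real_mono_of_forall_subset_edgeSet`), and integrating out the wired-off edges
(`SandwichUpper.rcMeasure_real_inter_mem_eq_fromEdgeSet`). (Grimmett 2006, Thm. (3.1)(a),
Lemmas 4.13, (4.14).) [cite: Grimmett2006, Lemma (4.14)] -/
theorem stub_loopSymmetricLimit_sandwichUpper : (∀ (V : Type) [Fintype V] [DecidableEq V] (G : SimpleGraph V) [DecidableRel G.Adj] (p q : ℝ), p ∈ Set.Icc (0 : ℝ) 1 → p < 1 → 1 ≤ q → ∀ (EΩ EQ : Finset (Sym2 V)), EΩ ⊆ G.edgeFinset → EQ ⊆ G.edgeFinset → ∀ (W Z : Set V), W ⊆ Z → (∀ e ∈ G.edgeFinset, e ∉ EQ → ∀ x ∈ e, x ∈ Z) → ∀ (A AQ : Set (Literature.Probability.Percolation.BondConfig V)), IsUpperSet A → (∀ ω : Literature.Probability.Percolation.BondConfig V, ω ⊆ G.edgeSet → ω ∩ ↑EΩ ∈ A → ω ∩ ↑EQ ∈ AQ) → (Literature.Probability.LatticeModels.rcMeasure (SimpleGraph.fromEdgeSet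 (↑EΩ : Set (Sym2 V))) p q W).real A ≤ (Literature.Probability.LatticeModels.rcMeasure (SimpleGraph.fromEdgeSet (↑EQ : Set (Sym2 V))) p q Z).real AQ) := by
  intro V _ _ G _ p q hp hp1 hq EΩ EQ hEΩ hEQ W Z hWZ hZ A AQ hA hdet
  have hq0 : 0 < q := one_pos.trans_le hq
  calc (rcMeasure (fromEdgeSet (↑EΩ : Set (Sym2 V))) p q W).real A
      ≤ (rcMeasure G p q Z).real {ω | ω ∩ ↑EΩ ∈ A} :=
        stub_loopSymmetricLimit_rcMeasure_mono_domain_wired V G p q hp hp1 hq EΩ hEΩ W Z hWZ A hA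
    _ ≤ (rcMeasure G p q Z).real {ω | ω ∩ ↑EQ ∈ AQ} :=
        rcMeasure_real_mono_of_forall_subset_edgeSet G hp hq0 Z fun ω hω h ↦ hdet ω hω h
    _ = (rcMeasure (fromEdgeSet (↑EQ : Set (Sym2 V))) p q Z).real AQ :=
        rcMeasure_real_inter_mem_eq_fromEdgeSet G hp hq0 Z EQ hEQ hZ AQ

end

end Summit.CriticalPhenomena.CardyFormulaZ2.Theorems.CardyQContinuation
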